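import Literature.Probability.Percolation.KozmaNitzanScheme
import Summits.CriticalPhenomena.PercolationContinuityZ3.Theorems.Transplant.KNLevelsDefs
import Summits.CriticalPhenomena.PercolationContinuityZ3.Theorems.Transplant.KNCellsScheme
import Literature.Probability.Percolation.OrientedHistorySiteRenormalizationRun
import HarnessLib

/-!
# N2 (frames-only node `SamePDropOfSkeletonFrm₁`, OPEN) — ORIENTED MACRO LAYER (WAVE 0 (c1), (R-18) `q ≡ true`): the oriented twin of N1's `KNCellsScheme`

builds on p205010 (kernel theorem, internal audit signed; external expert review pending) — nothing in this file uses p205010; NOTHING is claimed about the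
open node `SamePDropOfSkeletonFrm₁` (`SamePDropOfSkeletonNeg₁` is CLOSED in the tree and untouched by this file).
Status sentence (coordinator 2026-08-20T04:30Z): "θ(p_c) = 0 on ℤ^d, all d ≥ 2 — kernel-verified (Lean 4/Mathlib, standard axioms); internal adversarial
audit SIGNED 2026-08-20 04:29Z; external expert review pending."
Lane `prim-bschramm-*`, seat `prim-bschramm-stmt` (gen 19); helper file (`--supports stmt-CriticalPhenomena-4575 --as helper`); N2-SCOPE §20, (R-18)/(R-19).
PORT RULES (HOME/prim-bschramm-stmt-g19/lean/port_orient.py): the history-site API is replaced by its ORIENTED twin at the fixed quadrant `qNE := fun _ => true`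
(`HState.choice ↦ HState.ochoice qNE`, `mstOf ↦ omstOf qNE`, `mst/stN ↦ omst/ostN qNE`, `occFinal ↦ ooccFinal qNE`, `Lawful ↦ OLawful qNE`, onward directions
`onward ↦ onwardO` = the POSITIVE ones, (N2-e)); every declaration whose text changes thereby — directly or through a changed declaration — is re-declared with the
suffix `O` (same namespace); unchanged declarations of the N1 file are NOT repeated (the N1 module is imported). Docstrings/citations are N1's.
N1 HEADER (kept for the reader):
* §1 `CellGeom V A`, `vspan`; §2 `KSchA V A` and, verbatim from the original with the anchor threaded: `U₀`, `F`, `Vx` (KN's `E_i`),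
  `ξ`, `onward`, `seen`/`depA` (departure anchor read off the observation), `Sx`, `Fj`, `pat`, `Wt`, `Conn`, `cond` ((30)), `jOf`,
  `newRegion`, `envRegion` (over ALL admissible departure anchors), `env`, `revealOf`, `succA`; §3 locality (`depA_congr`, `jOf_congr`,
  `revealOf_congr`, `succA_congr`).  The probe / replay / validity / scheme are part 2 (`KNCellsProcess`).
NO geometric axiom (containment / disjointness / separation) is assumed; downstream files take the named facts they use as hypotheses.

[cite: KozmaNitzan2024, §4 pp. 25–29 ((29)–(32)), Figure 3 — the ℤ^d model] [cite: GrimmettPercolation1999, §7.2]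
-/
noncomputable section

open MeasureTheory ProbabilityTheory
open scoped ENNReal Classical

namespace Summit.CriticalPhenomena.PercolationContinuityZ3.Theorems

namespace Transplant

namespace KNCells

open Literature.Probability.Percolation Literature.Probability.LatticeModels SimpleGraph GadgetSystem ProbeHistory
open Literature.Probability.Percolation.KozmaNitzan (opens jIdx jIdx_lt jIdx_congr)

variable {V : Type*} [DecidableEq V]

/-! ## §1 Anchored cell geometries -/

namespace CellGeom

variable {A : Type*} (Γ : CellGeom V A)

end CellGeom

/-! ## §2 The anchored scheme: parameters and the examination of one macro-edge -/

namespace KSchA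

variable {A : Type*} (G : SimpleGraph V) [G.LocallyFinite] (S : KSchA V A)

/-! ## §0 (N2) The fixed quadrant and the ORIENTED onward directions ((R-18), (N2-e)) -/

/-- **The fixed quadrant of the oriented macro layer**: `qNE := fun _ => true` — both macro-axes are explored in their POSITIVE direction only ((R-18): the
working chart `ψ*` makes this WLOG; the oriented Peierls sentence `OrientedPeierlsBound` holds for every quadrant anyway). [this work] -/
abbrev qNE : Fin 2 → Bool := fun _ => true

/-- **The ORIENTED onward directions** out of `v` after history `h`: N1's onward directions (`KSchA.onward`: unexplored planar column) of POSITIVE sign,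
i.e. `onwardO ⊆ {(0, true), (1, true)}` ((N2-e): stubs, far regions and targets are laid out only toward the two positive neighbours — exactly the
targets an oriented candidate of the quadrant `qNE` can examine). [this work] -/
def onwardO (h : ProbeHistory V) (v : Site 2) : Finset MDir := (S.onward G h v).filter fun du => du.2 = qNE du.1

/-- An oriented onward direction is an onward direction. [folklore] -/
theorem onwardO_subset (h : ProbeHistory V) (v : Site 2) : S.onwardO G h v ⊆ S.onward G h v := Finset.filter_subset _ _

/-- An oriented onward direction is positive. [folklore] -/
theorem sign_of_mem_onwardO {h : ProbeHistory V} {v : Site 2} {du : MDir} (hdu : du ∈ S.onwardO G h v) : du.2 = true := (Finset.mem_filter.1 hdu).2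

/-- Membership in the oriented onward directions. [folklore] -/
theorem mem_onwardO {h : ProbeHistory V} {v : Site 2} {du : MDir} : du ∈ S.onwardO G h v ↔ du ∈ S.onward G h v ∧ du.2 = true := Finset.mem_filter

/-- The region revealed by the examination, given the observation (`E_{w,v} ∪ ⋃_x H^{j_x}_{v,x}`, stubs at the departure anchor).
[cite: KozmaNitzan2024, §4 p. 27 (E_{i+1})] -/
def newRegionO (h : ProbeHistory V) (e : Site 2 × MDir) (a a' : A) (o : Finset (Sym2 V)) : Finset V :=
  S.Γ.Ewv a e.1 e.2 ∪ (S.onwardO G h (tgt e)).biUnion fun du => S.Γ.Stub a' (tgt e) du (S.jOf G h e a a' du o)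

/-- The envelope region (`E_{w,v} ∪` the longest stubs at EVERY admissible departure anchor). [cite: KozmaNitzan2024, §4 p. 27] -/
def envRegionO (h : ProbeHistory V) (e : Site 2 × MDir) (a : A) : Finset V :=
  S.Γ.Ewv a e.1 e.2 ∪ (S.Γ.anchSet a (tgt e)).biUnion fun a' =>
    (S.onwardO G h (tgt e)).biUnion fun du => S.Γ.Stub a' (tgt e) du (S.Γ.K - 1)

/-- The envelope of the examination: the fresh edges of `G` inside `E_i ∪` envelope region. [cite: KozmaNitzan2024, §4 p. 27] -/
def envO (h : ProbeHistory V) (e : Site 2 × MDir) (a : A) : Finset (Sym2 V) :=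
  edgesIn G (S.Vx G h ∪ S.envRegionO G h e a) \ S.F G h

/-- The revealed edges given the observation: the fresh edges of `G` inside `E_i ∪` new region, the departure anchor read off `o`.
[cite: KozmaNitzan2024, §4 p. 27 (E_{i+1})] -/
def revealOfO (h : ProbeHistory V) (e : Site 2 × MDir) (a : A) (o : Finset (Sym2 V)) : Finset (Sym2 V) :=
  edgesIn G (S.Vx G h ∪ S.newRegionO G h e a (S.depA G h e a o) o) \ S.F G h

/-- **Success** at source anchor `a` ("declare `v` good … if all connections to all `x ∈ X` are good", with the stubs and targets at
the departure anchor read off the observation). [cite: KozmaNitzan2024, §4 p. 27] -/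
def succAO (h : ProbeHistory V) (e : Site 2 × MDir) (a : A) (o : Finset (Sym2 V)) : Prop :=
  ∀ du ∈ S.onwardO G h (tgt e), S.cond G h e a (S.depA G h e a o) du (S.jOf G h e a (S.depA G h e a o) du o) o

/-! ## §3 Locality -/

variable {G}

/-- `E_{w,v}` lies in the new region. [folklore] -/
theorem Ewv_subset_newRegionO (h : ProbeHistory V) (e : Site 2 × MDir) (a a' : A) (o : Finset (Sym2 V)) :
    S.Γ.Ewv a e.1 e.2 ⊆ S.newRegionO G h e a a' o := Finset.subset_union_left

/-- The new region lies in the envelope region (the departure anchor being admissible). [folklore] -/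
theorem newRegion_subset_envRegionO (h : ProbeHistory V) (e : Site 2 × MDir) (a : A) {a' : A}
    (ha' : a' ∈ S.Γ.anchSet a (tgt e)) (o : Finset (Sym2 V)) :
    S.newRegionO G h e a a' o ⊆ S.envRegionO G h e a := by
  intro y hy
  rcases Finset.mem_union.1 hy with hy | hy
  · exact Finset.mem_union_left _ hy
  · refine Finset.mem_union_right _ (Finset.mem_biUnion.2 ⟨a', ha', ?_⟩)
    rw [Finset.mem_biUnion] at hy ⊢
    obtain ⟨du, hdu, hy⟩ := hy
    exact ⟨du, hdu, S.Γ.stub_mono _ _ _ (by have := S.jOf_lt (G := G) h e a a' du o; omega) hy⟩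

/-- The new edges of `E_i ∪ E_{w,v}` are revealed (whatever the departure anchor). [folklore] -/
theorem baseF_sdiff_subset_revealOfO (h : ProbeHistory V) (e : Site 2 × MDir) (a : A) (o : Finset (Sym2 V)) :
    S.baseF G h e a \ S.F G h ⊆ S.revealOfO G h e a o := by
  refine Finset.sdiff_subset_sdiff ?_ le_rfl
  intro x hx
  rw [baseF, mem_edgesIn_iff] at hx
  rw [mem_edgesIn_iff]
  refine ⟨hx.1, fun y hy => ?_⟩
  rcases Finset.mem_union.1 (hx.2 y hy) with h' | h'
  · exact Finset.mem_union_left _ h'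
  · exact Finset.mem_union_right _ (S.Ewv_subset_newRegionO h e a _ o h')

/-- The revealed edges lie in the envelope. [folklore] -/
theorem revealOf_subset_envO (h : ProbeHistory V) (e : Site 2 × MDir) (a : A) (o : Finset (Sym2 V)) :
    S.revealOfO G h e a o ⊆ S.envO G h e a := by
  refine Finset.sdiff_subset_sdiff ?_ le_rfl
  intro x hx
  rw [mem_edgesIn_iff] at hx ⊢
  refine ⟨hx.1, fun y hy => ?_⟩
  rcases Finset.mem_union.1 (hx.2 y hy) with h' | h'
  · exact Finset.mem_union_left _ h'
  · exact Finset.mem_union_right _ (S.newRegion_subset_envRegionO h e a (S.Γ.anchor_mem _ _ _) o h')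

/-- The new conditioned edges at level `j ≤ j_x` of an onward direction are revealed (departure anchor read off `o`). [folklore] -/
theorem Fj_sdiff_subset_revealOfO {h : ProbeHistory V} {e : Site 2 × MDir} {a : A} {du : MDir}
    (hdu : du ∈ S.onwardO G h (tgt e)) {o : Finset (Sym2 V)} {j : ℕ}
    (hj : j ≤ S.jOf G h e a (S.depA G h e a o) du o) :
    S.Fj G h e a (S.depA G h e a o) du j \ S.F G h ⊆ S.revealOfO G h e a o := by
  refine Finset.sdiff_subset_sdiff ?_ le_rfl
  intro x hx
  rw [Fj, mem_edgesIn_iff] at hx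
  rw [mem_edgesIn_iff]
  refine ⟨hx.1, fun y hy => ?_⟩
  rcases Finset.mem_union.1 (hx.2 y hy) with h' | h'
  · rcases Finset.mem_union.1 h' with h'' | h''
    · exact Finset.mem_union_left _ h''
    · exact Finset.mem_union_right _ (Finset.mem_union_left _ h'')
  · refine Finset.mem_union_right _ (Finset.mem_union_right _ ?_)
    exact Finset.mem_biUnion.2 ⟨du, hdu, S.Γ.stub_mono _ _ _ hj h'⟩

/-- The new conditioned edges of an onward direction, at an admissible departure anchor, lie in the envelope. [folklore] -/
theorem Fj_sdiff_subset_envO (h : ProbeHistory V) (e : Site 2 × MDir) (a : A) {a' : A} (ha' : a' ∈ S.Γ.anchSet a (tgt e))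
    {du : MDir} (hdu : du ∈ S.onwardO G h (tgt e)) {j : ℕ} (hj : j < S.Γ.K) :
    S.Fj G h e a a' du j \ S.F G h ⊆ S.envO G h e a := by
  refine Finset.sdiff_subset_sdiff ?_ le_rfl
  intro x hx
  rw [Fj, mem_edgesIn_iff] at hx
  rw [mem_edgesIn_iff]
  refine ⟨hx.1, fun y hy => ?_⟩
  rcases Finset.mem_union.1 (hx.2 y hy) with h' | h'
  · rcases Finset.mem_union.1 h' with h'' | h''
    · exact Finset.mem_union_left _ h''
    · exact Finset.mem_union_right _ (Finset.mem_union_left _ h'')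
  · refine Finset.mem_union_right _ (Finset.mem_union_right _ ?_)
    exact Finset.mem_biUnion.2 ⟨a', ha', Finset.mem_biUnion.2 ⟨du, hdu, S.Γ.stub_mono _ _ _ (by omega) h'⟩⟩

/-- **Locality of `j_x`**: observations agreeing on the revealed edges give the same departure anchor, the same `j_x` and the same
goodness at `j_x`, for every onward direction. [folklore] -/
theorem jOf_congrO {h : ProbeHistory V} {e : Site 2 × MDir} {a : A} {du : MDir} (hdu : du ∈ S.onwardO G h (tgt e))
    {o o' : Finset (Sym2 V)} (hoo' : ∀ x ∈ S.revealOfO G h e a o, x ∈ o ↔ x ∈ o') :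
    S.jOf G h e a (S.depA G h e a o') du o' = S.jOf G h e a (S.depA G h e a o) du o ∧
      (S.cond G h e a (S.depA G h e a o') du (S.jOf G h e a (S.depA G h e a o) du o) o' ↔
        S.cond G h e a (S.depA G h e a o) du (S.jOf G h e a (S.depA G h e a o) du o) o) := by
  have hdep : S.depA G h e a o' = S.depA G h e a o :=
    S.depA_congr h e a fun x hx => hoo' x (S.baseF_sdiff_subset_revealOfO h e a o hx)
  rw [hdep]
  exact S.jOf_congr_of fun j hj x hx => hoo' x (S.Fj_sdiff_subset_revealOfO hdu hj hx)

/-- **Locality of the revealed set.** [folklore] -/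
theorem revealOf_congrO {h : ProbeHistory V} {e : Site 2 × MDir} {a : A} {o o' : Finset (Sym2 V)}
    (hoo' : ∀ x ∈ S.revealOfO G h e a o, x ∈ o ↔ x ∈ o') : S.revealOfO G h e a o' = S.revealOfO G h e a o := by
  have hdep : S.depA G h e a o' = S.depA G h e a o :=
    S.depA_congr h e a fun x hx => hoo' x (S.baseF_sdiff_subset_revealOfO h e a o hx)
  unfold revealOfO newRegionO
  rw [hdep]
  have : ∀ du ∈ S.onwardO G h (tgt e), S.jOf G h e a (S.depA G h e a o) du o' = S.jOf G h e a (S.depA G h e a o) du o :=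
    fun du hdu => by have := (S.jOf_congrO hdu hoo').1; rwa [hdep] at this
  rw [Finset.biUnion_congr rfl fun du hdu => by rw [this du hdu]]

/-- **Locality of success.** [folklore] -/
theorem succA_congrO {h : ProbeHistory V} {e : Site 2 × MDir} {a : A} {o o' : Finset (Sym2 V)}
    (hoo' : ∀ x ∈ S.revealOfO G h e a o, x ∈ o ↔ x ∈ o') : S.succAO G h e a o' ↔ S.succAO G h e a o := by
  unfold succAO
  refine forall₂_congr fun du hdu => ?_
  obtain ⟨h1, h2⟩ := S.jOf_congrO hdu hoo'
  rw [h1, h2]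

end KSchA

end KNCells

end Transplant

end Summit.CriticalPhenomena.PercolationContinuityZ3.Theorems

end
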